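import Literature.MathematicalPhysics.QuantumFieldTheory.Balaban1983to89.MatrixNorms

/-!
# `Balaban1983to89.B7Eq57Adjoint` — T. Bałaban, *Averaging operations for lattice gauge theories*, Commun. Math. Phys. **98**
(1985) 17–51 [Balaban1985Averaging], Sect. C p. 27 [PDF 11]: **the last identity of (57), `R(X)* = R(X*)`** — the adjoint of the
rotation `R(X)Y = XYX⁻¹` (56) with respect to the scalar product `⟨X, Y⟩ = tr X*Y` (17) p. 20 — PROVED on `M_N(ℂ)`

statement-level skeleton of published theorems with citation tags; proofs where landed; nothing here is a claim about the Yang–Mills mass gap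

PDF held: `paper:balaban1985-cmp98-averaging` (journal page = PDF page + 16); renders `…/1985-cmp98-averaging-p011-x2.png` (p. 27) and
`…-p004-x2.png` (p. 20) read as images by the typing seat (unit `lit-balaban-r04`, gen 52).

CITATION HEADER / PRINT, verbatim (p. 27): "where for arbitrary invertible matrix `X` the operator `R(X)` is given by the formula
`R(X)Y = XYX⁻¹`. (56)  `R(X)` acts on the algebra of all matrices and has the following properties: `R(X)f(Y) = f(R(X)Y)` for analytic
functions `f`, `R(X)R(Y) = R(XY)`, `R(X)⁻¹ = R(X⁻¹)`, `R(X)* = R(X*)`. (57)"  (p. 20, (17): "We introduce a scalar product in the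
algebra of all complex matrices `⟨X, Y⟩ = tr X*Y, tr X = (1/N) Σ_j X_jj`".)

THE TREE ALREADY HAS (row `B7.Eq55` of ROWS-B7): (56) `B7Eq92Concrete.Rc` (on the group of units) ∕ `B7Eq78Linearization.conjR` (on the
algebra), (57)₂ `Rc_mul`, (57)₃ `Rc_inv_apply`, (57)₁ for the two analytic functions print applies it to (`B7Eq92Concrete.expUnit_conj`,
`mlog_Rc`).  THIS FILE adds (57)₄, which is a statement about the scalar product (17) and therefore lives on `M_N(ℂ)` with
`MatrixNorms.nhsInner` (`⟨X, Y⟩ = ntr (Xᴴ * Y)`, the NORMALIZED trace `ntr`): `⟨R(X)A, B⟩ = ⟨A, R(X*)B⟩` for all matrices `A`, `B` —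
i.e. the adjoint of the operator `R(X)` on `(M_N(ℂ), ⟨·,·⟩)` is `R(X*)`.  Matrix inverse = Mathlib's `Matrix.nonsing_inv`; for an
invertible `X` (print's hypothesis) it is the two-sided inverse, and the identity below holds even without invertibility (both sides
are then computed with the same generalized inverse, `(Xᴴ)⁻¹ = (X⁻¹)ᴴ`).

WHAT THIS FILE PROVES (kernel, 0 sorry, standard axioms; no definitions, no `def … : Prop`).
* `nhsInner_conj_left` — **(57)₄**: `⟨XAX⁻¹, B⟩ = ⟨A, X*B(X*)⁻¹⟩`.
* `nhsInner_conj_conj_of_unitary` — the use print makes of it for `G ⊂ U(N)`: for `X*X = 1`, `R(X)* = R(X*) = R(X⁻¹) = R(X)⁻¹`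
  ((57)₃), so `R(X)` preserves the scalar product (17): `⟨XAX⁻¹, XBX⁻¹⟩ = ⟨A, B⟩`.
Owner audit context: ROWS-B7 row `B7.Eq55` ((55)–(59)); this member puts the fourth identity of display (57) in the tree.
Unit `lit-balaban-r04` gen 52, 2026-08-23.
-/

open scoped BigOperators Matrix ComplexConjugate

namespace Literature.MathematicalPhysics.QuantumFieldTheory.Balaban1983to89

namespace B7Eq57Adjoint

open MatrixNorms

noncomputable section

variable {n : Type*} [Fintype n] [DecidableEq n]

/-- Bookkeeping for (57)₄: the matrix inside the trace on the left, `(XAX⁻¹)ᴴB`, and on the right, `Aᴴ(XᴴB(Xᴴ)⁻¹)`, have the same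
trace (cyclicity of the trace and `(Xᴴ)⁻¹ = (X⁻¹)ᴴ`). [cite: Balaban1985Averaging, (57) p.27] -/
theorem trace_conj_left (X A B : Matrix n n ℂ) :
    ((X * A * X⁻¹)ᴴ * B).trace = (Aᴴ * (Xᴴ * B * (Xᴴ)⁻¹)).trace := by
  rw [← Matrix.conjTranspose_nonsing_inv, Matrix.conjTranspose_mul, Matrix.conjTranspose_mul]
  -- LHS: (X⁻¹ᴴ * (Aᴴ * Xᴴ)) * B ;  RHS: Aᴴ * (Xᴴ * B * X⁻¹ᴴ)
  calc (X⁻¹ᴴ * (Aᴴ * Xᴴ) * B).trace = (X⁻¹ᴴ * (Aᴴ * Xᴴ * B)).trace := by rw [Matrix.mul_assoc]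
    _ = (Aᴴ * Xᴴ * B * X⁻¹ᴴ).trace := Matrix.trace_mul_comm _ _
    _ = (Aᴴ * (Xᴴ * B * X⁻¹ᴴ)).trace := by simp only [Matrix.mul_assoc]

/-- **(57), last identity: `R(X)* = R(X*)`** — the adjoint of the rotation `R(X)Y = XYX⁻¹` (56) with respect to the scalar product
`⟨X, Y⟩ = tr X*Y` (17): `⟨R(X)A, B⟩ = ⟨A, R(X*)B⟩` for all `A, B ∈ M_N(ℂ)` (`X*` = `Xᴴ`; `tr` = the normalized trace `ntr`, the
normalization cancels). [cite: Balaban1985Averaging, (57) p.27, (56) p.27, (17) p.20] -/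
theorem nhsInner_conj_left (X A B : Matrix n n ℂ) :
    nhsInner (X * A * X⁻¹) B = nhsInner A (Xᴴ * B * (Xᴴ)⁻¹) := by
  unfold nhsInner ntr
  rw [trace_conj_left]

/-- (57)₄ read from the right: `⟨A, R(X)B⟩ = ⟨R(X*)A, B⟩`. [cite: Balaban1985Averaging, (57) p.27, (17) p.20] -/
theorem nhsInner_conj_right (X A B : Matrix n n ℂ) :
    nhsInner A (X * B * X⁻¹) = nhsInner (Xᴴ * A * (Xᴴ)⁻¹) B := by
  rw [nhsInner_conj_left, Matrix.conjTranspose_conjTranspose]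

/-- **For `X ∈ U(N)` the rotation `R(X)` preserves the scalar product (17)** — (57)₄ with (57)₃: `R(X)* = R(X*) = R(X⁻¹) = R(X)⁻¹`
when `X*X = 1` (print's `G` is a subgroup of `U(N)`, p. 20): `⟨XAX⁻¹, XBX⁻¹⟩ = ⟨A, B⟩`. [cite: Balaban1985Averaging, (57) p.27, (17) p.20] -/
theorem nhsInner_conj_conj_of_unitary {X : Matrix n n ℂ} (hX : Xᴴ * X = 1) (A B : Matrix n n ℂ) :
    nhsInner (X * A * X⁻¹) (X * B * X⁻¹) = nhsInner A B := by
  have hXinv : X⁻¹ = Xᴴ := Matrix.inv_eq_left_inv hX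
  have hHinv : (Xᴴ)⁻¹ = X := by
    rw [← Matrix.conjTranspose_nonsing_inv, hXinv, Matrix.conjTranspose_conjTranspose]
  rw [nhsInner_conj_left, hHinv, hXinv]
  -- `Xᴴ (X B Xᴴ) X = (XᴴX) B (XᴴX) = B`
  have hB : Xᴴ * (X * B * Xᴴ) * X = B := by
    calc Xᴴ * (X * B * Xᴴ) * X = (Xᴴ * X) * B * (Xᴴ * X) := by simp only [Matrix.mul_assoc]
      _ = B := by rw [hX, Matrix.one_mul, Matrix.mul_one]
  rw [hB]

end

end B7Eq57Adjoint

end Literature.MathematicalPhysics.QuantumFieldTheory.Balaban1983to89
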